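import Summits.QuantumFields.GaugeBoot.Certificates.SparseReducedWindow
import Summits.QuantumFields.GaugeBoot.Certificates.KZL2rpD4b11493o5000LoDA
import Summits.QuantumFields.GaugeBoot.Certificates.KZL2rpD4b11493o5000LoDB
import HarnessLib

/-!
# Kernel replay of the certsdp certificate `kzL2_D4_b11493o5000_max_rp_G2-lower` — part G: factor-row assembly and objective (gb_lean_emit_win 0.10)

HONEST FRAMING (cell `pub-gaugeboot`): certified bounds on lattice expectations at stated coupling,
gauge group, dimension and torus size; NOT a mass gap, NOT a continuum limit, NOT a string tension;
NOT Yang–Mills-summit-bearing (barriers `FixedCouplingUltralocality`, `PerturbativeInvisibility`).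

Certificate sha256 `6d1be07f02d4472a4571944a3accb92d64c361ee8826920f31a70862323f4f7f` (problem `kzL2_D4_b11493o5000_max_rp_G2-lower`, sha256 `1b01c6795e1343aa8d12c21260e303d15d1bdf771a14e93caf983e7d54d6ed2e`): `GB` = all factor rows (data parts
`Certificates/KZL2rpD4b11493o5000LoD….lean` concatenated), the INTEGER objective row `cZ`, the certified bound `lowerQ`, and the kernel check
`gb_len` (factor rows fit the padded dimension 48). Windows: `Certificates/KZL2rpD4b11493o5000LoA….lean`; assembly + theorems: `Certificates/KZL2rpD4b11493o5000Lo.lean`.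
Data/plumbing only; nothing is claimed about lattice gauge theory in this file.
-/

namespace Summit.QuantumFields.GaugeBoot.Certificates.KZL2rpD4b11493o5000Lo

noncomputable section

open Summit.QuantumFields.GaugeBoot.Certificates.Sparse

/-- All factor rows (concatenation of the data parts' block lists). -/
def GB : List (List (List ℤ)) := GBa ++ GBb

/-- Objective as a sparse INTEGER row: (1)·y_1. -/
def cZ : List (ℕ × ℤ) := [(1, 1)]

/-- The certified lower bound on the objective (exact): `134028381292150744864324719604480897650998468600011/298009146614582448875451182166835200000000000000000` (≈ 0.4497458645640). -/
def lowerQ : ℚ := 134028381292150744864324719604480897650998468600011/298009146614582448875451182166835200000000000000000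

set_option maxHeartbeats 0 in
/-- Kernel check: every factor row of every block has length `≤ 48`. -/
theorem gb_len : lenCheckAll KZL2rpD4b11493o5000Lo.GB 48 70 = true := by
  decide +kernel

end

end Summit.QuantumFields.GaugeBoot.Certificates.KZL2rpD4b11493o5000Lo
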